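import Literature.Probability.LatticeModels.CumulantRecursion
import Mathlib.Order.Partition.Finpartition
import HarnessLib

/-!
# The explicit Möbius formula for Ursell functions and cumulants

Topic `Literature/Probability/LatticeModels`; continues `UrsellInversion.lean` / `CumulantRecursion.lean`.
There the Ursell (truncated) function `ursellOf m` of a moment function `m` on finite sets is DEFINED
by Möbius inversion, i.e. by the cluster decomposition `m(V) = Σ_{π} ∏_{P∈π} mᵀ(P)` (Ruelle 1969,
§4.4.1 (4.5)–(4.7)).  Here we prove the classical EXPLICIT formula
`mᵀ(V) = Σ_{π ∈ setPartitions V} (-1)^{|π|-1} (|π|-1)! ∏_{P ∈ π} m(P)`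
(the Möbius function of the partition lattice; e.g. Camia–Jiang–Newman 2023, eq. (2):
`u_k(σ_1,…,σ_k) = Σ_𝒫 (-1)^{|𝒫|-1}(|𝒫|-1)! ∏_{P∈𝒫} ⟨σ_P⟩`, stated there as equivalent to the
definition (1) by `∂^k log⟨exp Σ h_j σ_j⟩`), its symmetric case for the cumulants `cumulantOf μ n` of a
moment sequence, and the re-indexation of such sums by Mathlib's `Finpartition`.

## Main results

* `sum_filter_explicitUrsell_mul` — the explicit sum satisfies the block recursion
  `Σ_{v ∈ Q ⊆ W} u(Q) m(W ∖ Q) = m(W)`;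
* `ursellOf_eq_sum_setPartitions` — the explicit formula for `ursellOf m V` (`m ∅ = 1`, `V ≠ ∅`);
* `cumulantOf_eq_sum_setPartitions` — `κ_n = Σ_{π ∈ setPartitions [n]} (-1)^{|π|-1}(|π|-1)! ∏ μ_{|P|}`;
* `sum_finpartition_eq_sum_setPartitions` — `Σ_{P : Finpartition V} f P.parts = Σ_{π ∈ setPartitions V} f π`.

## Proof of the explicit formula

Both sides satisfy the block recursion at a vertex `v ∈ W` (`sum_ursellOf_mul_eq` for `ursellOf`), and
the block recursion determines its solution by strong induction on `W` (as in
`FermionicTreeExpansion.eq_ursellOf_of_block_recursion`, re-proved inline to keep the imports light).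
For the explicit sum: a pair (`Q ∋ v`, `Q ≠ W`, `ρ ∈ setPartitions Q`) is the same as a pair
(`π ∈ setPartitions W`, a block `B₀ ∈ π` with `v ∉ B₀`) via `π = insert (W ∖ Q) ρ`; a partition `π` of
`W` with `r` blocks has `r - 1` blocks avoiding `v`, and `(-1)^{r-1}(r-1)! + (r-1)·(-1)^{r-2}(r-2)! = 0`
for `r ≥ 2`, so only the one-block partition `{W}` survives, contributing `m(W)`.  No new definitions.

## References

* D. Ruelle, *Statistical Mechanics: Rigorous Results* (1969), §4.4.1 (4.5)–(4.7) [Ruelle1969].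
* F. Camia, J. Jiang, C. M. Newman, *Monotonicity of Ursell functions in the Ising model*,
  Comm. Math. Phys. 401 (2023), §1.1 eqs. (1)–(2) [CamiaJiangNewman2023].
-/

open Finset

namespace Literature.Probability.LatticeModels

variable {α : Type*} [DecidableEq α] {C : Type*} [CommRing C]

/-! ### Small facts about set partitions -/

/-- In a set partition of `W`, exactly one block contains a given `v ∈ W`; hence the blocks
avoiding `v` number `#π - 1`. [folklore] -/
theorem IsSetPartition.card_filter_not_mem {W : Finset α} {π : Finset (Finset α)}
    (h : IsSetPartition W π) {v : α} (hv : v ∈ W) :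
    (π.filter fun B => v ∉ B).card = π.card - 1 := by
  have h1 : (π.filter fun B => v ∈ B).card = 1 := by
    rw [h.filter_mem_eq (h.blockOf_mem hv) (h.mem_blockOf hv), card_singleton]
  have h2 := Finset.card_filter_add_card_filter_not (s := π) (fun B => v ∈ B)
  omega

omit [DecidableEq α] in
/-- A set partition with exactly one block is the one-block partition. [folklore] -/
theorem IsSetPartition.eq_singleton_of_card_eq_one {W : Finset α} {π : Finset (Finset α)}
    (h : IsSetPartition W π) (hcard : π.card = 1) : π = {W} := by
  obtain ⟨B, hB⟩ := card_eq_one.1 hcard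
  have hBmem : B ∈ π := hB ▸ mem_singleton_self B
  have hBW : B = W := by
    refine Subset.antisymm (h.subset hBmem) fun w hw => ?_
    obtain ⟨P, hP, hwP⟩ := h.exists_mem hw
    rw [hB, mem_singleton] at hP
    exact hP ▸ hwP
  rw [hB, hBW]

omit [DecidableEq α] in
/-- A set partition of a nonempty set is a nonempty family. [folklore] -/
theorem IsSetPartition.card_pos {W : Finset α} {π : Finset (Finset α)} (h : IsSetPartition W π)
    (hW : W.Nonempty) : 0 < π.card := by
  obtain ⟨v, hv⟩ := hW
  obtain ⟨P, hP, -⟩ := h.exists_mem hv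
  exact Finset.card_pos.2 ⟨P, hP⟩

/-- The Möbius coefficients `c_r = (-1)^{r-1}(r-1)!` satisfy `c_r + (r-1) c_{r-1} = [r = 1]` for
`r ≥ 1`. [folklore] -/
theorem moebiusCoeff_add_mul (r : ℕ) (hr : 0 < r) :
    ((-1 : C) ^ (r - 1) * ((r - 1).factorial : C) +
      ((r - 1 : ℕ) : C) * ((-1 : C) ^ (r - 1 - 1) * ((r - 1 - 1).factorial : C))) =
      if r = 1 then 1 else 0 := by
  rcases r with _ | _ | s
  · exact absurd hr (lt_irrefl 0)
  · simp
  · simp only [Nat.add_sub_cancel, Nat.factorial_succ, Nat.cast_mul, Nat.cast_add, Nat.cast_one,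
      pow_succ]
    rw [if_neg (by omega)]
    ring

/-! ### The explicit sum satisfies the block recursion -/

/-- **Block recursion for the explicit Möbius sum.** For `v ∈ W` and `m ∅ = 1`,
`Σ_{v ∈ Q ⊆ W} (Σ_{ρ ∈ setPartitions Q} (-1)^{|ρ|-1}(|ρ|-1)! ∏_{B∈ρ} m B) · m(W ∖ Q) = m(W)`.
[folklore] -/
theorem sum_filter_explicitUrsell_mul (m : Finset α → C) (hm0 : m ∅ = 1) {W : Finset α} {v : α}
    (hv : v ∈ W) :
    ∑ Q ∈ W.powerset.filter (fun Q => v ∈ Q),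
      (∑ ρ ∈ setPartitions Q, (-1 : C) ^ (ρ.card - 1) * ((ρ.card - 1).factorial : C) *
        ∏ B ∈ ρ, m B) * m (W \ Q) = m W := by
  -- notation
  set c : ℕ → C := fun r => (-1 : C) ^ (r - 1) * ((r - 1).factorial : C) with hc
  have hWmem : W ∈ W.powerset.filter (fun Q => v ∈ Q) := by simp [hv]
  rw [← add_sum_erase _ _ hWmem, sdiff_self, Finset.bot_eq_empty, hm0, mul_one]
  -- the proper blocks `Q ∋ v`, re-indexed by (π, B₀ ∌ v)
  have hbij : ∑ Q ∈ (W.powerset.filter (fun Q => v ∈ Q)).erase W,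
      (∑ ρ ∈ setPartitions Q, c ρ.card * ∏ B ∈ ρ, m B) * m (W \ Q) =
      ∑ π ∈ setPartitions W, ∑ B₀ ∈ π.filter (fun B => v ∉ B), c (π.card - 1) * ∏ B ∈ π, m B := by
    simp_rw [sum_mul]
    rw [sum_sigma', sum_sigma']
    refine sum_nbij'
      (fun x => (⟨insert (W \ x.1) x.2, W \ x.1⟩ : Σ _ : Finset (Finset α), Finset α))
      (fun y => (⟨W \ y.2, y.1.erase y.2⟩ : Σ _ : Finset α, Finset (Finset α))) ?_ ?_ ?_ ?_ ?_
    · rintro ⟨Q, ρ⟩ hx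
      simp only [mem_sigma, mem_erase, mem_filter, mem_powerset, mem_setPartitions] at hx ⊢
      obtain ⟨⟨hQW, hQsub, hvQ⟩, hρ⟩ := hx
      have hsd : (W \ Q).Nonempty := by
        rw [sdiff_nonempty]; exact fun h => hQW (Subset.antisymm hQsub h)
      refine ⟨?_, mem_insert_self _ _, fun h => (mem_sdiff.1 h).2 hvQ⟩
      have hρ' : IsSetPartition (W \ (W \ Q)) ρ := by rwa [Finset.sdiff_sdiff_eq_self hQsub]
      exact hρ'.insert sdiff_subset hsd
    · rintro ⟨π, B₀⟩ hy
      simp only [mem_sigma, mem_erase, mem_filter, mem_powerset, mem_setPartitions] at hy ⊢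
      obtain ⟨hπ, hB₀π, hvB₀⟩ := hy
      have hB₀W : B₀ ⊆ W := hπ.subset hB₀π
      have hB₀ne : B₀.Nonempty := hπ.nonempty_of_mem hB₀π
      refine ⟨⟨fun h => ?_, sdiff_subset, mem_sdiff.2 ⟨hv, hvB₀⟩⟩, hπ.erase hB₀π⟩
      obtain ⟨w, hw⟩ := hB₀ne
      have hw' : w ∈ W \ B₀ := by rw [h]; exact hB₀W hw
      exact (mem_sdiff.1 hw').2 hw
    · rintro ⟨Q, ρ⟩ hx
      simp only [mem_sigma, mem_erase, mem_filter, mem_powerset, mem_setPartitions] at hx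
      obtain ⟨⟨hQW, hQsub, hvQ⟩, hρ⟩ := hx
      have hsd : (W \ Q).Nonempty := by
        rw [sdiff_nonempty]; exact fun h => hQW (Subset.antisymm hQsub h)
      have hρ' : IsSetPartition (W \ (W \ Q)) ρ := by rwa [Finset.sdiff_sdiff_eq_self hQsub]
      have hnot : W \ Q ∉ ρ := hρ'.notMem_of_sdiff hsd
      simp only [Finset.sdiff_sdiff_eq_self hQsub, erase_insert hnot]
    · rintro ⟨π, B₀⟩ hy
      simp only [mem_sigma, mem_filter, mem_setPartitions] at hy
      obtain ⟨hπ, hB₀π, hvB₀⟩ := hy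
      have hB₀W : B₀ ⊆ W := hπ.subset hB₀π
      simp only [Finset.sdiff_sdiff_eq_self hB₀W, insert_erase hB₀π]
    · rintro ⟨Q, ρ⟩ hx
      simp only [mem_sigma, mem_erase, mem_filter, mem_powerset, mem_setPartitions] at hx
      obtain ⟨⟨hQW, hQsub, hvQ⟩, hρ⟩ := hx
      have hsd : (W \ Q).Nonempty := by
        rw [sdiff_nonempty]; exact fun h => hQW (Subset.antisymm hQsub h)
      have hρ' : IsSetPartition (W \ (W \ Q)) ρ := by rwa [Finset.sdiff_sdiff_eq_self hQsub]
      have hnot : W \ Q ∉ ρ := hρ'.notMem_of_sdiff hsd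
      simp only [card_insert_of_notMem hnot, Nat.add_sub_cancel, prod_insert hnot]
      ring
  rw [hbij]
  -- collect: each `π` contributes `(c_{|π|} + (|π|-1) c_{|π|-1}) ∏ m = [|π| = 1] ∏ m`
  have hcollect : ∑ ρ ∈ setPartitions W, c ρ.card * ∏ B ∈ ρ, m B +
      ∑ π ∈ setPartitions W, ∑ B₀ ∈ π.filter (fun B => v ∉ B), c (π.card - 1) * ∏ B ∈ π, m B =
      ∑ π ∈ setPartitions W, (if π.card = 1 then (1 : C) else 0) * ∏ B ∈ π, m B := by
    rw [← sum_add_distrib]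
    refine sum_congr rfl fun π hπ => ?_
    have h := mem_setPartitions.1 hπ
    rw [sum_const, h.card_filter_not_mem hv, nsmul_eq_mul, ← mul_assoc, ← add_mul]
    congr 1
    have key := moebiusCoeff_add_mul (C := C) π.card (h.card_pos ⟨v, hv⟩)
    simp only [hc]
    rw [← key]
  rw [hcollect]
  -- only the one-block partition `{W}` survives
  have hWne : W.Nonempty := ⟨v, hv⟩
  have hmem : {W} ∈ setPartitions W := mem_setPartitions.2 (isSetPartition_singleton hWne)
  rw [sum_eq_single_of_mem {W} hmem]
  · simp
  · intro π hπ hne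
    have h := mem_setPartitions.1 hπ
    rw [if_neg (fun h1 => hne (h.eq_singleton_of_card_eq_one h1)), zero_mul]

/-! ### The explicit formula -/

/-- **The explicit Möbius formula for the Ursell function** (Ruelle 1969, §4.4.1 (4.6), "`Γ⁻¹`
corresponding to the logarithm"; Camia–Jiang–Newman 2023, eq. (2)): for `m ∅ = 1` and nonempty `V`,
`mᵀ(V) = Σ_{π ∈ setPartitions V} (-1)^{|π|-1} (|π|-1)! ∏_{P ∈ π} m(P)`.
[cite: CamiaJiangNewman2023, §1.1 eq. (2)] -/
theorem ursellOf_eq_sum_setPartitions (m : Finset α → C) (hm0 : m ∅ = 1) {V : Finset α}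
    (hV : V.Nonempty) :
    ursellOf m V = ∑ π ∈ setPartitions V,
      (-1 : C) ^ (π.card - 1) * ((π.card - 1).factorial : C) * ∏ P ∈ π, m P := by
  -- uniqueness for the block recursion, by strong induction on `V`
  set u : Finset α → C := fun Q => ∑ ρ ∈ setPartitions Q,
    (-1 : C) ^ (ρ.card - 1) * ((ρ.card - 1).factorial : C) * ∏ B ∈ ρ, m B with hu
  change ursellOf m V = u V
  induction V using Finset.strongInduction with
  | H W ih =>
    obtain ⟨v, hv⟩ := hV
    have h1 := sum_filter_explicitUrsell_mul m hm0 hv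
    have h2 := sum_ursellOf_mul_eq m hm0 hv
    have hW : W ∈ W.powerset.filter (fun Q => v ∈ Q) := by simp [hv]
    rw [← add_sum_erase _ _ hW, sdiff_self, Finset.bot_eq_empty, hm0, mul_one] at h1 h2
    have h3 : ∑ Q ∈ (W.powerset.filter (fun Q => v ∈ Q)).erase W, u Q * m (W \ Q) =
        ∑ Q ∈ (W.powerset.filter (fun Q => v ∈ Q)).erase W, ursellOf m Q * m (W \ Q) := by
      refine sum_congr rfl fun Q hQ => ?_
      obtain ⟨hne, hQ'⟩ := mem_erase.1 hQ
      obtain ⟨hQW, hvQ⟩ := mem_filter.1 hQ'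
      rw [ih Q (Finset.ssubset_iff_subset_ne.2 ⟨mem_powerset.1 hQW, hne⟩) ⟨v, hvQ⟩]
    change u W + _ = m W at h1
    linear_combination h2 - h1 + h3

/-- **The explicit formula for cumulants**: for a moment sequence `μ` with `μ 0 = 1`,
`κ_n = Σ_{π ∈ setPartitions {0,…,n-1}} (-1)^{|π|-1} (|π|-1)! ∏_{P ∈ π} μ_{|P|}` for `n ≥ 1` (the
usual moment–cumulant formula; at `n = 0` the left side is the junk value `0` and the right side is
`1`). [folklore] -/
theorem cumulantOf_eq_sum_setPartitions (μ : ℕ → C) (hμ : μ 0 = 1) {n : ℕ} (hn : 0 < n) :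
    cumulantOf μ n = ∑ π ∈ setPartitions (univ : Finset (Fin n)),
      (-1 : C) ^ (π.card - 1) * ((π.card - 1).factorial : C) * ∏ P ∈ π, μ P.card := by
  haveI : Nonempty (Fin n) := ⟨⟨0, hn⟩⟩
  exact ursellOf_eq_sum_setPartitions (fun P : Finset (Fin n) => μ P.card) (by simpa using hμ)
    univ_nonempty

/-! ### Re-indexation by Mathlib's `Finpartition` -/

/-- Sums over Mathlib's `Finpartition V` are sums over `setPartitions V` (the map `P ↦ P.parts` is a
bijection, `mem_setPartitions_iff_exists_finpartition`). [folklore] -/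
theorem sum_finpartition_eq_sum_setPartitions {M : Type*} [AddCommMonoid M] (V : Finset α)
    (f : Finset (Finset α) → M) :
    ∑ P : Finpartition V, f P.parts = ∑ π ∈ setPartitions V, f π := by
  refine sum_nbij (fun P : Finpartition V => P.parts) ?_ ?_ ?_ (fun _ _ => rfl)
  · intro P _
    exact mem_setPartitions.2 (isSetPartition_parts P)
  · intro P _ Q _ h
    exact Finpartition.ext h
  · intro π hπ
    obtain ⟨P, hP⟩ := mem_setPartitions_iff_exists_finpartition.1 (mem_coe.1 hπ)
    exact ⟨P, mem_coe.2 (mem_univ _), hP⟩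

/-- The explicit formula for cumulants indexed by `Finpartition`:
`κ_n = Σ_{P : Finpartition univ} (-1)^{|P.parts|-1} (|P.parts|-1)! ∏_{B ∈ P.parts} μ_{|B|}`.
[folklore] -/
theorem cumulantOf_eq_sum_finpartition (μ : ℕ → C) (hμ : μ 0 = 1) {n : ℕ} (hn : 0 < n) :
    cumulantOf μ n = ∑ P : Finpartition (univ : Finset (Fin n)),
      (-1 : C) ^ (P.parts.card - 1) * ((P.parts.card - 1).factorial : C) *
        ∏ B ∈ P.parts, μ B.card := by
  rw [cumulantOf_eq_sum_setPartitions μ hμ hn,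
    ← sum_finpartition_eq_sum_setPartitions (univ : Finset (Fin n))
      (fun π => (-1 : C) ^ (π.card - 1) * ((π.card - 1).factorial : C) * ∏ B ∈ π, μ B.card)]

/-- The explicit formula for the Ursell function of a moment function on `Fin n`, indexed by
`Finpartition`. [folklore] -/
theorem ursellOf_univ_eq_sum_finpartition {n : ℕ} (m : Finset (Fin n) → C) (hm0 : m ∅ = 1)
    (hn : 0 < n) :
    ursellOf m univ = ∑ P : Finpartition (univ : Finset (Fin n)),
      (-1 : C) ^ (P.parts.card - 1) * ((P.parts.card - 1).factorial : C) * ∏ B ∈ P.parts, m B := by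
  haveI : Nonempty (Fin n) := ⟨⟨0, hn⟩⟩
  rw [ursellOf_eq_sum_setPartitions m hm0 univ_nonempty,
    ← sum_finpartition_eq_sum_setPartitions (univ : Finset (Fin n))
      (fun π => (-1 : C) ^ (π.card - 1) * ((π.card - 1).factorial : C) * ∏ B ∈ π, m B)]

end Literature.Probability.LatticeModels
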